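import Literature.Probability.LatticeModels.GaussianPairingBoundCouplings
import Literature.Probability.LatticeModels.GriffithsMonotonicity
import Mathlib.Analysis.SpecialFunctions.Artanh
import HarnessLib

/-!
# RobustBall/IsingBallB2 — the Ising model on the radius-2 ball `B₂` of `ℤ³` (25 sites) EXACTLY at `tanh β = 4/21`: the core sum of the
# third rung of the Simon–Lieb ladder for the centre-blind window

HONEST FRAMING: venture file of the cell `pub-ymgap` (QuantumFields programme), track Y2 ROBUST-BALL / DS seat ds-4 (g10).  A finite computation
about the classical nearest-neighbour Ising model (free boundary condition, zero field) on ONE explicit finite graph with 25 vertices; nothing about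
`SU(2)`, the torus or the continuum is in this file.  It is the arithmetic heart of RUNG 3 of the `β`-ladder for the centre-blind window of `SU(2)`
lattice gauge theory (`CentreBlindStarWindow` = rung 2, stars; `IsingSetDecay` = the ladder engine): the Simon–Lieb certificate of the `ℓ¹`-ball `B₂`
of the three-dimensional layer needs the two-point functions `⟨σ_0 σ_x⟩_{B₂}` — here the CORE quantity `∑_{m} ⟨σ_0 σ_m⟩_{B₂;β₀}` over the six middle
sites `m = ±e_k`, at the coupling `β₀ = artanh(4/21) = 0.19283…` (`e^{2β₀} = 25/17`), as an EXACT RATIONAL NUMBER.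

WHAT.  `B2V` = the 25 sites (centre, `mid k s = ±e_k`, `axis k s = ±2e_k`, `corner k s s' = ±e_{k+1} ± e_{k+2}`), `b2Graph` = the induced subgraph of
`ℤ³` (36 edges: centre–middle, middle–axis, corner–its two middles; `edgeFinset_b2Graph`, kernel-decided).  MECHANISM (high-temperature representation +
summing out the 18 boundary spins): `e^{β σ_xσ_y} = cosh β (1 + tanh β σ_xσ_y)`; an axis spin `u` contributes `∑_u (1 + t m u) = 2`, a corner spin
`∑_u (1 + t m₁ u)(1 + t m₂ u) = 2(1 + t² m₁m₂)`; so every expectation of a CORE observable (centre + six middles) is a ratio of two sums over the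
`2⁷ = 128` core configurations with the polynomial weight `∏_m (1 + t σ_0 m) ∏_corners (1 + t² m₁ m₂)` (`sum_cfg_eq_const_mul_coreSum`), which at
`t = 4/21` the kernel evaluates in integers (`coreSum_one`, `coreSum_obs`):
`∑_m ⟨σ_0 σ_m⟩_{B₂; artanh(4/21)} = 798142860945322720752737108351832962153472 / 604781407537015484375897954513554089641088 = 1.3197212…`
(`sum_isingTwoPoint_centre_mid_eq`; two independent arithmetic lineages — the `e^{2β} = 25/17` transfer form and this `tanh` form — agree, session
notes of ds-4 g10).  The boundary two-point functions, the certificate and the window theorem are in `IsingBallB2Bound` / `CentreBlindBallWindow`.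

References: B. Simon, Comm. Math. Phys. 77 (1980) 111; E. Lieb, Comm. Math. Phys. 77 (1980) 127; S. Friedli, Y. Velenik (2017) §3.7.3
(high-temperature representation) [FriedliVelenik2017].
-/

noncomputable section

open Finset
open Literature.Probability.LatticeModels

namespace Summit.Ventures.YMGap.RobustBall

/-! ### The ball `B₂` as an explicit graph -/

/-- The 25 vertices of the `ℓ¹`-ball of radius `2` in `ℤ³`: the centre, the six middle sites `±e_k`, the six axis sites `±2e_k` and the
twelve corners `±e_{k+1} ± e_{k+2}` (indexed by the MISSING axis `k : Fin 3` and two signs). [folklore] -/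
inductive B2V : Type
  | centre : B2V
  | mid (k : Fin 3) (s : Bool) : B2V
  | axis (k : Fin 3) (s : Bool) : B2V
  | corner (k : Fin 3) (s s' : Bool) : B2V
  deriving DecidableEq

namespace B2V

/-- `B2V` as a sum of products (for enumeration). [folklore] -/
def equivSum : B2V ≃ (Unit ⊕ (Fin 3 × Bool)) ⊕ ((Fin 3 × Bool) ⊕ (Fin 3 × Bool × Bool)) where
  toFun
    | centre => Sum.inl (Sum.inl ())
    | mid k s => Sum.inl (Sum.inr (k, s))
    | axis k s => Sum.inr (Sum.inl (k, s))
    | corner k s s' => Sum.inr (Sum.inr (k, s, s'))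
  invFun
    | Sum.inl (Sum.inl ()) => centre
    | Sum.inl (Sum.inr (k, s)) => mid k s
    | Sum.inr (Sum.inl (k, s)) => axis k s
    | Sum.inr (Sum.inr (k, s, s')) => corner k s s'
  left_inv p := by cases p <;> rfl
  right_inv q := by rcases q with (⟨⟨⟩⟩ | ⟨k, s⟩) | (⟨k, s⟩ | ⟨k, s, s'⟩) <;> rfl

/-- `B2V` is finite (25 elements). [folklore] -/
instance : Fintype B2V := Fintype.ofEquiv _ equivSum.symm

/-- The adjacency of the induced subgraph of `ℤ³` on the ball: centre–middle, middle–axis (same direction and sign), middle–corner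
(the corner's two unit components). [folklore] -/
def adj : B2V → B2V → Prop
  | centre, mid _ _ => True
  | mid _ _, centre => True
  | mid k s, axis k' s' => k = k' ∧ s = s'
  | axis k' s', mid k s => k = k' ∧ s = s'
  | mid k s, corner u t t' => (k = u + 1 ∧ s = t) ∨ (k = u + 2 ∧ s = t')
  | corner u t t', mid k s => (k = u + 1 ∧ s = t) ∨ (k = u + 2 ∧ s = t')
  | _, _ => False

/-- `adj` is symmetric. [folklore] -/
theorem adj_symm {p q : B2V} (h : adj p q) : adj q p := by
  cases p <;> cases q <;> simp only [adj] at h ⊢ <;> assumption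

/-- `adj` is irreflexive. [folklore] -/
theorem adj_irrefl (p : B2V) : ¬adj p p := by
  cases p <;> simp [adj]

/-- `adj` is decidable. [folklore] -/
instance : DecidableRel adj := fun p q => by
  cases p <;> cases q <;> simp only [adj] <;> infer_instance

end B2V

open B2V

/-- **The ball graph `B₂`** (induced subgraph of `ℤ³` on the radius-2 `ℓ¹`-ball). [folklore] -/
def b2Graph : SimpleGraph B2V where
  Adj := B2V.adj
  symm := ⟨fun _ _ h => B2V.adj_symm h⟩
  loopless := ⟨fun p => B2V.adj_irrefl p⟩

/-- Adjacency of `b2Graph` is decidable. [folklore] -/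
instance : DecidableRel b2Graph.Adj := fun p q => inferInstanceAs (Decidable (B2V.adj p q))

/-- Adjacency of `b2Graph` is `B2V.adj`. [folklore] -/
theorem b2Graph_adj (p q : B2V) : b2Graph.Adj p q ↔ B2V.adj p q := Iff.rfl

/-- The centre–middle edges. [folklore] -/
def edgesCM : Finset (Sym2 B2V) := univ.image fun ks : Fin 3 × Bool => s(centre, mid ks.1 ks.2)

/-- The middle–axis edges. [folklore] -/
def edgesMA : Finset (Sym2 B2V) := univ.image fun ks : Fin 3 × Bool => s(mid ks.1 ks.2, axis ks.1 ks.2)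

/-- The corner–(first middle) edges. [folklore] -/
def edgesC1 : Finset (Sym2 B2V) := univ.image fun c : Fin 3 × Bool × Bool => s(corner c.1 c.2.1 c.2.2, mid (c.1 + 1) c.2.1)

/-- The corner–(second middle) edges. [folklore] -/
def edgesC2 : Finset (Sym2 B2V) := univ.image fun c : Fin 3 × Bool × Bool => s(corner c.1 c.2.1 c.2.2, mid (c.1 + 2) c.2.2)

/-- **The 36 edges of `B₂`** (kernel-decided). [folklore] -/
theorem edgeFinset_b2Graph : b2Graph.edgeFinset = edgesCM ∪ edgesMA ∪ edgesC1 ∪ edgesC2 := by decide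

/-- A product over the edges of `B₂` splits into the three families. [folklore] -/
theorem prod_edgeFinset_b2Graph (f : Sym2 B2V → ℝ) :
    ∏ e ∈ b2Graph.edgeFinset, f e =
      (∏ ks : Fin 3 × Bool, f s(centre, mid ks.1 ks.2)) * (∏ ks : Fin 3 × Bool, f s(mid ks.1 ks.2, axis ks.1 ks.2)) *
        ∏ c : Fin 3 × Bool × Bool, (f s(corner c.1 c.2.1 c.2.2, mid (c.1 + 1) c.2.1) * f s(corner c.1 c.2.1 c.2.2, mid (c.1 + 2) c.2.2)) := by
  have hd1 : Disjoint edgesCM edgesMA := by decide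
  have hd2 : Disjoint (edgesCM ∪ edgesMA) edgesC1 := by decide
  have hd3 : Disjoint (edgesCM ∪ edgesMA ∪ edgesC1) edgesC2 := by decide
  rw [edgeFinset_b2Graph, prod_union hd3, prod_union hd2, prod_union hd1]
  unfold edgesCM edgesMA edgesC1 edgesC2
  rw [prod_image (by decide), prod_image (by decide), prod_image (by decide), prod_image (by decide), prod_mul_distrib]
  ring

/-! ### Core configurations and the reduced weight -/

/-- A core configuration: the centre spin and the six middle spins `(σ_0; m_{0+}, m_{0−}, m_{1+}, m_{1−}, m_{2+}, m_{2−})`. [folklore] -/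
abbrev B2Cfg : Type := ℤˣ × ℤˣ × ℤˣ × ℤˣ × ℤˣ × ℤˣ × ℤˣ

/-- The middle spin `m_{k,s}` of a core configuration. [folklore] -/
def B2Cfg.m (x : B2Cfg) (k : Fin 3) (s : Bool) : ℤˣ :=
  if s then ![x.2.1, x.2.2.2.1, x.2.2.2.2.2.1] k else ![x.2.2.1, x.2.2.2.2.1, x.2.2.2.2.2.2] k

/-- A spin as a real number. [folklore] -/
def sp (u : ℤˣ) : ℝ := ((u : ℤ) : ℝ)

/-- `sp 1 = 1`. [folklore] -/
@[simp] theorem sp_one : sp 1 = 1 := by simp [sp]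

/-- `sp (−1) = −1`. [folklore] -/
@[simp] theorem sp_neg_one : sp (-1) = -1 := by simp [sp]

/-- `sp u = ±1`. [folklore] -/
theorem sp_eq_or (u : ℤˣ) : sp u = 1 ∨ sp u = -1 := by
  rcases Int.units_eq_one_or u with rfl | rfl <;> simp

/-- `sp u ^ 2 = 1`. [folklore] -/
theorem sp_sq (u : ℤˣ) : sp u * sp u = 1 := by
  rcases sp_eq_or u with h | h <;> rw [h] <;> norm_num

/-- A sum over `ℤˣ` has two terms. [folklore] -/
theorem sum_units (f : ℤˣ → ℝ) : ∑ u, f u = f 1 + f (-1) := by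
  rw [UnitsInt.univ, Finset.sum_pair (by decide)]

/-- **The reduced core weight at `tanh β = 4/21`, cleared of denominators**:
`W(x) = ∏_{k,s} (21 + 4 σ_0 m_{k,s}) · ∏_{corners} (441 + 16 m_{k+1,s} m_{k+2,s'})` (an integer). [folklore] -/
def coreW (x : B2Cfg) : ℝ :=
  (∏ ks : Fin 3 × Bool, (21 + 4 * sp x.1 * sp (x.m ks.1 ks.2))) *
    ∏ c : Fin 3 × Bool × Bool, (441 + 16 * sp (x.m (c.1 + 1) c.2.1) * sp (x.m (c.1 + 2) c.2.2))

/-- The core observable `σ_0 · (sum of the six middle spins)`. [folklore] -/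
def coreObs (x : B2Cfg) : ℝ := sp x.1 * ∑ ks : Fin 3 × Bool, sp (x.m ks.1 ks.2)

/-- Arithmetic in `Fin 3`. [folklore] -/
theorem fin3_add : ((0 : Fin 3) + 1 = 1 ∧ (0 : Fin 3) + 2 = 2 ∧ (1 : Fin 3) + 1 = 2) ∧
    ((1 : Fin 3) + 2 = 0 ∧ (2 : Fin 3) + 1 = 0 ∧ (2 : Fin 3) + 2 = 1) := by decide

/-- **KERNEL ARITHMETIC, denominator**: `∑_x W(x) = 604781407537015484375897954513554089641088`. [folklore] -/
theorem coreSum_one : ∑ x : B2Cfg, coreW x = 604781407537015484375897954513554089641088 := by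
  simp only [coreW, Fintype.prod_prod_type, Fin.prod_univ_three, Fintype.prod_bool, B2Cfg.m, fin3_add, if_true,
    if_false, Bool.false_eq_true, Matrix.cons_val_zero, Matrix.cons_val_one, Matrix.cons_val_two, Matrix.head_cons,
    Matrix.tail_cons, Fintype.sum_prod_type, sum_units, sp_one, sp_neg_one]
  norm_num

/-- **KERNEL ARITHMETIC, numerator**: `∑_x σ_0 M(x) W(x) = 798142860945322720752737108351832962153472`. [folklore] -/
theorem coreSum_obs : ∑ x : B2Cfg, coreObs x * coreW x = 798142860945322720752737108351832962153472 := by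
  simp only [coreW, coreObs, Fintype.prod_prod_type, Fin.prod_univ_three, Fintype.prod_bool, B2Cfg.m, fin3_add, if_true,
    if_false, Bool.false_eq_true, Matrix.cons_val_zero, Matrix.cons_val_one, Matrix.cons_val_two, Matrix.head_cons,
    Matrix.tail_cons, Fintype.sum_prod_type, Fin.sum_univ_three, Fintype.sum_bool, sum_units, sp_one, sp_neg_one]
  norm_num

/-! ### Splitting a configuration into core and boundary spins -/

/-- The configuration space of `B₂` as (core 7-tuple) × (axis spins) × (corner spins). [folklore] -/
def cfgEquiv : SpinConfig B2V ≃ B2Cfg × ((Fin 3 × Bool → ℤˣ) × (Fin 3 × Bool × Bool → ℤˣ)) where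
  toFun σ := ((σ centre, σ (mid 0 true), σ (mid 0 false), σ (mid 1 true), σ (mid 1 false), σ (mid 2 true), σ (mid 2 false)),
    (fun ks => σ (axis ks.1 ks.2), fun c => σ (corner c.1 c.2.1 c.2.2)))
  invFun y p := match p with
    | centre => y.1.1
    | mid k s => y.1.m k s
    | axis k s => y.2.1 (k, s)
    | corner k s s' => y.2.2 (k, s, s')
  left_inv σ := by
    funext p
    cases p with
    | centre => rfl
    | mid k s => fin_cases k <;> cases s <;> rfl
    | axis k s => rfl
    | corner k s s' => rfl
  right_inv y := by
    obtain ⟨⟨c, m0p, m0m, m1p, m1m, m2p, m2m⟩, fa, fc⟩ := y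
    rfl

/-- Spins of the split configuration: centre. [folklore] -/
@[simp] theorem cfgEquiv_symm_centre (y : B2Cfg × ((Fin 3 × Bool → ℤˣ) × (Fin 3 × Bool × Bool → ℤˣ))) :
    cfgEquiv.symm y centre = y.1.1 := rfl

/-- Spins of the split configuration: middle sites. [folklore] -/
@[simp] theorem cfgEquiv_symm_mid (y : B2Cfg × ((Fin 3 × Bool → ℤˣ) × (Fin 3 × Bool × Bool → ℤˣ))) (k : Fin 3) (s : Bool) :
    cfgEquiv.symm y (mid k s) = y.1.m k s := rfl

/-- Spins of the split configuration: axis sites. [folklore] -/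
@[simp] theorem cfgEquiv_symm_axis (y : B2Cfg × ((Fin 3 × Bool → ℤˣ) × (Fin 3 × Bool × Bool → ℤˣ))) (k : Fin 3) (s : Bool) :
    cfgEquiv.symm y (axis k s) = y.2.1 (k, s) := rfl

/-- Spins of the split configuration: corners. [folklore] -/
@[simp] theorem cfgEquiv_symm_corner (y : B2Cfg × ((Fin 3 × Bool → ℤˣ) × (Fin 3 × Bool × Bool → ℤˣ))) (k : Fin 3) (s s' : Bool) :
    cfgEquiv.symm y (corner k s s') = y.2.2 (k, s, s') := rfl

/-- `spinAt p σ = sp (σ p)`. [folklore] -/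
theorem spinAt_eq_sp (p : B2V) (σ : SpinConfig B2V) : spinAt p σ = sp (σ p) := rfl

/-! ### The high-temperature representation and the boundary sums -/

/-- `e^{Jb} = cosh J (1 + tanh J · b)` for `b = ±1`. [cite: FriedliVelenik2017, §3.7.3] -/
theorem exp_mul_sign (J : ℝ) {b : ℝ} (hb : b = 1 ∨ b = -1) : Real.exp (J * b) = Real.cosh J * (1 + Real.tanh J * b) := by
  have hc : Real.cosh J ≠ 0 := (Real.cosh_pos J).ne'
  rw [Real.tanh_eq_sinh_div_cosh]
  rcases hb with rfl | rfl
  · rw [mul_one, ← Real.cosh_add_sinh]; field_simp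
  · rw [mul_neg_one, ← Real.cosh_sub_sinh]; field_simp; ring

/-- **High-temperature form of the Boltzmann weight of `B₂`**, split along the three edge families. [cite: FriedliVelenik2017, §3.7.3] -/
theorem weight_eq (J : ℝ) (σ : SpinConfig B2V) :
    Real.exp (J * ∑ e ∈ b2Graph.edgeFinset, bondSpin σ e) =
      Real.cosh J ^ 36 * ((∏ ks : Fin 3 × Bool, (1 + Real.tanh J * (spinAt centre σ * spinAt (mid ks.1 ks.2) σ))) *
        (∏ ks : Fin 3 × Bool, (1 + Real.tanh J * (spinAt (mid ks.1 ks.2) σ * spinAt (axis ks.1 ks.2) σ))) *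
        ∏ c : Fin 3 × Bool × Bool, ((1 + Real.tanh J * (spinAt (corner c.1 c.2.1 c.2.2) σ * spinAt (mid (c.1 + 1) c.2.1) σ)) *
          (1 + Real.tanh J * (spinAt (corner c.1 c.2.1 c.2.2) σ * spinAt (mid (c.1 + 2) c.2.2) σ)))) := by
  rw [mul_sum, Real.exp_sum]
  have h1 : ∏ e ∈ b2Graph.edgeFinset, Real.exp (J * bondSpin σ e) =
      ∏ e ∈ b2Graph.edgeFinset, (Real.cosh J * (1 + Real.tanh J * bondSpin σ e)) :=
    prod_congr rfl fun e _ => exp_mul_sign J (bondSpin_eq_one_or σ e)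
  have hcard : b2Graph.edgeFinset.card = 36 := by rw [edgeFinset_b2Graph]; decide
  rw [h1, prod_mul_distrib, prod_const, hcard, prod_edgeFinset_b2Graph]
  simp only [bondSpin_mk]

/-- **Summing out the axis spins**: `∑_{fa} ∏_{ks} (1 + t m_{ks} u_{ks}) = 2⁶`. [folklore] -/
theorem axis_sum (t : ℝ) (m : Fin 3 × Bool → ℝ) :
    ∑ fa : Fin 3 × Bool → ℤˣ, ∏ ks : Fin 3 × Bool, (1 + t * (m ks * sp (fa ks))) = 2 ^ 6 := by
  rw [← Fintype.prod_sum fun (ks : Fin 3 × Bool) (u : ℤˣ) => 1 + t * (m ks * sp u)]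
  have h : ∀ ks : Fin 3 × Bool, ∑ u : ℤˣ, (1 + t * (m ks * sp u)) = 2 := fun ks => by
    rw [sum_units, sp_one, sp_neg_one]; ring
  rw [prod_congr rfl fun ks _ => h ks, prod_const]
  simp

/-- **Summing out the corner spins**: `∑_{fc} ∏_c (1 + t u_c m₁)(1 + t u_c m₂) = 2¹² ∏_c (1 + t² m₁ m₂)`. [folklore] -/
theorem corner_sum (t : ℝ) (m₁ m₂ : Fin 3 × Bool × Bool → ℝ) :
    ∑ fc : Fin 3 × Bool × Bool → ℤˣ, ∏ c : Fin 3 × Bool × Bool, ((1 + t * (sp (fc c) * m₁ c)) * (1 + t * (sp (fc c) * m₂ c))) =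
      2 ^ 12 * ∏ c : Fin 3 × Bool × Bool, (1 + t ^ 2 * m₁ c * m₂ c) := by
  rw [← Fintype.prod_sum fun (c : Fin 3 × Bool × Bool) (u : ℤˣ) => (1 + t * (sp u * m₁ c)) * (1 + t * (sp u * m₂ c))]
  have h : ∀ c : Fin 3 × Bool × Bool, ∑ u : ℤˣ, (1 + t * (sp u * m₁ c)) * (1 + t * (sp u * m₂ c)) = 2 * (1 + t ^ 2 * m₁ c * m₂ c) :=
    fun c => by rw [sum_units, sp_one, sp_neg_one]; ring
  rw [prod_congr rfl fun c _ => h c, prod_mul_distrib, prod_const]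
  simp

/-- **CORE REDUCTION**: for an observable of the core spins, the Boltzmann sum over all `2²⁵` configurations of `B₂` is
`cosh^{36}J · 2^{18}` times a sum over the `2⁷` core configurations with the polynomial weight
`∏_{ks}(1 + t σ_0 m_{ks}) ∏_c (1 + t² m₁(c) m₂(c))`, `t = tanh J`. [cite: FriedliVelenik2017, §3.7.3] -/
theorem sum_cfg_eq_coreSum (J : ℝ) (F : B2Cfg → ℝ) :
    ∑ σ : SpinConfig B2V, F (cfgEquiv σ).1 * Real.exp (J * ∑ e ∈ b2Graph.edgeFinset, bondSpin σ e) =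
      Real.cosh J ^ 36 * 2 ^ 18 * ∑ x : B2Cfg, F x *
        ((∏ ks : Fin 3 × Bool, (1 + Real.tanh J * (sp x.1 * sp (x.m ks.1 ks.2)))) *
          ∏ c : Fin 3 × Bool × Bool, (1 + Real.tanh J ^ 2 * sp (x.m (c.1 + 1) c.2.1) * sp (x.m (c.1 + 2) c.2.2))) := by
  set t := Real.tanh J with ht
  simp_rw [weight_eq J, spinAt_eq_sp]
  rw [← cfgEquiv.symm.sum_comp, Fintype.sum_prod_type, mul_sum]
  refine sum_congr rfl fun x _ => ?_
  rw [Fintype.sum_prod_type]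
  simp only [Equiv.apply_symm_apply, cfgEquiv_symm_centre, cfgEquiv_symm_mid, cfgEquiv_symm_axis, cfgEquiv_symm_corner]
  -- factor the sums over the axis and corner spins
  have hA := axis_sum t (fun ks => sp (x.m ks.1 ks.2))
  have hC := corner_sum t (fun c => sp (x.m (c.1 + 1) c.2.1)) (fun c => sp (x.m (c.1 + 2) c.2.2))
  calc ∑ fa : Fin 3 × Bool → ℤˣ, ∑ fc : Fin 3 × Bool × Bool → ℤˣ, F x * (Real.cosh J ^ 36 *
          ((∏ ks : Fin 3 × Bool, (1 + t * (sp x.1 * sp (x.m ks.1 ks.2)))) *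
            (∏ ks : Fin 3 × Bool, (1 + t * (sp (x.m ks.1 ks.2) * sp (fa (ks.1, ks.2))))) *
            ∏ c : Fin 3 × Bool × Bool, ((1 + t * (sp (fc (c.1, c.2.1, c.2.2)) * sp (x.m (c.1 + 1) c.2.1))) *
              (1 + t * (sp (fc (c.1, c.2.1, c.2.2)) * sp (x.m (c.1 + 2) c.2.2))))))
        = F x * Real.cosh J ^ 36 * (∏ ks : Fin 3 × Bool, (1 + t * (sp x.1 * sp (x.m ks.1 ks.2)))) *
            ((∑ fa : Fin 3 × Bool → ℤˣ, ∏ ks : Fin 3 × Bool, (1 + t * (sp (x.m ks.1 ks.2) * sp (fa ks)))) *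
             ∑ fc : Fin 3 × Bool × Bool → ℤˣ, ∏ c : Fin 3 × Bool × Bool,
               ((1 + t * (sp (fc c) * sp (x.m (c.1 + 1) c.2.1))) * (1 + t * (sp (fc c) * sp (x.m (c.1 + 2) c.2.2))))) := by
          rw [sum_mul_sum]
          rw [mul_sum]
          refine sum_congr rfl fun fa _ => ?_
          rw [mul_sum]
          refine sum_congr rfl fun fc _ => ?_
          ring
    _ = _ := by rw [hA, hC]; ring


/-! ### The rung-3 coupling `β₀ = artanh(4/21)` and the exact core expectation -/

/-- **The rung-3 coupling** `β₀ = artanh(4/21) = ½ log(25/17) = 0.192831…` (so `tanh β₀ = 4/21`, `e^{2β₀} = 25/17`). [folklore] -/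
def b2Beta : ℝ := Real.artanh (4 / 21)

/-- `tanh β₀ = 4/21`. [folklore] -/
theorem tanh_b2Beta : Real.tanh b2Beta = 4 / 21 :=
  Real.tanh_artanh (by constructor <;> norm_num)

/-- `0 < β₀`. [folklore] -/
theorem b2Beta_pos : 0 < b2Beta := Real.artanh_pos (by constructor <;> norm_num)

/-- The polynomial core weight at `t = 4/21` is `W(x) / (21⁶ · 441¹²)`. [folklore] -/
theorem coreProd_eq_coreW_div (x : B2Cfg) :
    (∏ ks : Fin 3 × Bool, (1 + (4 / 21 : ℝ) * (sp x.1 * sp (x.m ks.1 ks.2)))) *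
        ∏ c : Fin 3 × Bool × Bool, (1 + (4 / 21 : ℝ) ^ 2 * sp (x.m (c.1 + 1) c.2.1) * sp (x.m (c.1 + 2) c.2.2)) =
      coreW x / (21 ^ 6 * 441 ^ 12) := by
  have h1 : ∀ ks : Fin 3 × Bool, (1 + (4 / 21 : ℝ) * (sp x.1 * sp (x.m ks.1 ks.2))) = (21 + 4 * sp x.1 * sp (x.m ks.1 ks.2)) / 21 :=
    fun ks => by ring
  have h2 : ∀ c : Fin 3 × Bool × Bool, (1 + (4 / 21 : ℝ) ^ 2 * sp (x.m (c.1 + 1) c.2.1) * sp (x.m (c.1 + 2) c.2.2)) =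
      (441 + 16 * sp (x.m (c.1 + 1) c.2.1) * sp (x.m (c.1 + 2) c.2.2)) / 441 := fun c => by ring
  simp only [h1, h2, prod_div_distrib, prod_const, card_univ, Fintype.card_prod, Fintype.card_fin, Fintype.card_bool, coreW]
  norm_num
  ring

/-- **EXACT CORE EXPECTATIONS AT `β₀`**: for every observable `F` of the core spins,
`⟨F⟩^∅_{B₂;β₀} = (∑_x F(x) W(x)) / ∑_x W(x)` (sums over the `128` core configurations, `W` = `coreW`). [cite: FriedliVelenik2017, §3.7.3] -/
theorem isingExpect_core_eq (F : B2Cfg → ℝ) :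
    isingExpect b2Graph univ b2Beta 0 .free (fun σ => F (cfgEquiv σ).1) = (∑ x : B2Cfg, F x * coreW x) / ∑ x : B2Cfg, coreW x := by
  rw [PairIsing.isingExpect_univ_free_eq_sum_div, sum_cfg_eq_coreSum b2Beta F]
  have hden := sum_cfg_eq_coreSum b2Beta (fun _ => (1 : ℝ))
  simp only [one_mul] at hden
  rw [hden, tanh_b2Beta]
  simp only [coreProd_eq_coreW_div]
  have hK : (0 : ℝ) < Real.cosh b2Beta ^ 36 * 2 ^ 18 := by positivity
  rw [mul_div_mul_left _ _ hK.ne']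
  simp only [mul_div_assoc', ← sum_div]
  rw [div_div_div_cancel_right₀ (by norm_num)]

/-- The core tuple of a configuration reads the middle spins. [folklore] -/
theorem cfgEquiv_fst_m (σ : SpinConfig B2V) (k : Fin 3) (s : Bool) : (cfgEquiv σ).1.m k s = σ (mid k s) := by
  fin_cases k <;> cases s <;> rfl

/-- The core tuple of a configuration reads the centre spin. [folklore] -/
theorem cfgEquiv_fst_fst (σ : SpinConfig B2V) : (cfgEquiv σ).1.1 = σ centre := rfl

/-- **THE EXACT CORE NUMBER OF RUNG 3**: `∑_{k,s} ⟨σ_0 σ_{mid k s}⟩^∅_{B₂; artanh(4/21)} =`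
`798142860945322720752737108351832962153472 / 604781407537015484375897954513554089641088 = 1.3197212…`. [folklore] -/
theorem sum_isingTwoPoint_centre_mid_eq :
    ∑ ks : Fin 3 × Bool, isingTwoPoint b2Graph univ b2Beta 0 .free centre (mid ks.1 ks.2) =
      798142860945322720752737108351832962153472 / 604781407537015484375897954513554089641088 := by
  have hobs : (fun σ : SpinConfig B2V => ∑ ks : Fin 3 × Bool, spinPair centre (mid ks.1 ks.2) σ) =
      fun σ => coreObs (cfgEquiv σ).1 := by
    funext σ
    simp only [coreObs, spinPair, spinAt_eq_sp, cfgEquiv_fst_m, cfgEquiv_fst_fst, mul_sum]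
  have hsum := isingExpect_finset_sum' b2Graph univ 0 BoundaryCondition.free b2Beta (univ : Finset (Fin 3 × Bool))
    (fun ks σ => spinPair centre (mid ks.1 ks.2) σ) (fun ks => measurable_spinPair centre (mid ks.1 ks.2))
  unfold isingTwoPoint
  rw [hobs, isingExpect_core_eq coreObs, coreSum_obs, coreSum_one] at hsum
  exact hsum.symm

end Summit.Ventures.YMGap.RobustBall

end
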